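import Mathlib

/-!
# Hilbert 90 for the norm-one elements of a CM field (T3.1, ROUTE.md §9.8(f); seat t3-p1)

PERIOD-ADDENDUM-5.md §2(e) uses «`x ↦ x/x̄` maps `K^×` onto `E′¹ = {t : t t̄ = 1}`» (Hilbert 90 for
the torus `U(1)`) to turn a character of `E′¹(𝔸)/E′¹` with prescribed archimedean exponents
(`Tier3PrescribedExponents.lean`) into a twist of the splitting character by even exponent shifts.
This file records the ALGEBRAIC half of that sentence:

* `exists_div_apply_eq_of_mul_apply_eq_one`: for a field `L` with a ring automorphism `σ` of
  order two (`σ ∘ σ = id`, `σ ≠ id`) and `t` with `t · σ t = 1`, there is `x ≠ 0` with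
  `x / σ x = t` (`x = 1 + t` if `t ≠ -1`; `x = a − σ a` with `σ a ≠ a` if `t = -1`);
* `exists_div_complexConj_eq`: the instance for the complex conjugation of a CM field
  (Mathlib `NumberField.IsCMField.complexConj`).

The same algebra applies in every non-split completion; at a split place the statement is
`(x, y) ↦ (x/y, y/x)`; the restricted-product bookkeeping of the adelic statement stays on paper
(ADDENDUM-5 §2(a), §2(e)).  The file declares no definition and no notation; nothing here asserts
anything about the Hodge conjecture, which is NOT proved by anyone in this repository.
-/

namespace HodgeRepro.T3P1.NormOneHilbert90

/-- **Hilbert 90 for the norm-one elements of an involution**: for a field `L` with a ring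
automorphism `σ` of order two (`σ ∘ σ = id`, `σ ≠ id`) and `t` with `t · σ t = 1`, there is
`x ≠ 0` with `x / σ x = t`. -/
theorem exists_div_apply_eq_of_mul_apply_eq_one {L : Type*} [Field L] (σ : L ≃+* L)
    (hσ : ∀ x, σ (σ x) = x) (hne : ∃ a, σ a ≠ a) {t : L} (ht : t * σ t = 1) :
    ∃ x : L, x ≠ 0 ∧ x / σ x = t := by
  by_cases h1 : t = -1
  · obtain ⟨a, ha⟩ := hne
    refine ⟨a - σ a, sub_ne_zero.mpr (Ne.symm ha), ?_⟩
    have hx : σ (a - σ a) = -(a - σ a) := by rw [map_sub, hσ, neg_sub]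
    rw [hx, h1, div_neg, div_self (sub_ne_zero.mpr (Ne.symm ha))]
  · have ht0 : t ≠ 0 := by rintro rfl; simp at ht
    have hσt : σ t = t⁻¹ := eq_inv_of_mul_eq_one_right ht
    have h1t : 1 + t ≠ 0 := by
      intro h; apply h1; linear_combination h
    refine ⟨1 + t, h1t, ?_⟩
    rw [map_add, map_one, hσt]
    have : (1 + t⁻¹) = (1 + t) / t := by field_simp; ring
    rw [this, div_div_eq_mul_div, mul_div_cancel_left₀ _ h1t]

/-- The CM-field instance: `x ↦ x / x̄` maps `K^×` onto the norm-one elements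
`E′¹ = {t : t t̄ = 1}` (global Hilbert 90 for the torus `U(1)`). -/
theorem exists_div_complexConj_eq (K : Type*) [Field K] [CharZero K]
    [NumberField.IsCMField K] [Algebra.IsIntegral ℚ K] {t : K}
    (ht : t * NumberField.IsCMField.complexConj K t = 1) :
    ∃ x : K, x ≠ 0 ∧ x / NumberField.IsCMField.complexConj K x = t := by
  apply exists_div_apply_eq_of_mul_apply_eq_one (NumberField.IsCMField.complexConj K).toRingEquiv
    (fun x => NumberField.IsCMField.complexConj_apply_apply K x) _ ht
  by_contra hall
  apply NumberField.IsCMField.complexConj_ne_one K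
  ext x
  exact not_not.mp (fun h => hall ⟨x, h⟩)

end HodgeRepro.T3P1.NormOneHilbert90

/-!
## Appendix (v2): `δ_β` by weak approximation (ROUTE.md §9.8(f), second clause)

The other «standard, not quoted from a held page» clause of §9.8(f) — «δ_β by weak
approximation» — asks for a purely imaginary `δ ∈ E′` (`δ̄ = −δ`) whose imaginary part has a
prescribed sign at every real place of `E′⁺` (the sign of the skew-hermitian line `L` at that
place).  Mathlib's weak approximation at the infinite places (`denseRange_algebraMap_pi`) gives it:
`exists_forall_sign_im_embedding` (prescribed signs of `Im` at every place, from one element with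
non-real image everywhere) and `exists_complexConj_eq_neg_forall_sign_im` (the CM-field form with
`δ = a − ā`).
-/

namespace HodgeRepro.T3P1.NormOneHilbert90

open NumberField NumberField.InfinitePlace

section WeakApproximation

variable (K : Type*) [Field K] [NumberField K]

omit [NumberField K] in
/-- The coordinate map `y ↦ embedding w (equiv y w)` is continuous on the product of the
`WithAbs` topologies (Mathlib's `isometry_embedding`). -/
theorem continuous_embedding_apply (w : InfinitePlace K) :
    Continuous fun y : (v : InfinitePlace K) → WithAbs v.1 =>
      w.embedding (WithAbs.equiv w.1 (y w)) :=
  (w.isometry_embedding).continuous.comp (continuous_apply w)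

/-- **Weak approximation with prescribed signs of the imaginary parts.** If some `a₀ ∈ K` has
`(embedding w a₀).im ≠ 0` at every infinite place `w`, then for every sign vector `s` (`s w ≠ 0`)
there is `a ∈ K` with `sign (embedding w a).im = sign (s w)` at every `w`
(Mathlib `denseRange_algebraMap_pi` = weak approximation at the infinite places). -/
theorem exists_forall_sign_im_embedding (a₀ : K) (ha₀ : ∀ w : InfinitePlace K, (w.embedding a₀).im ≠ 0)
    (s : InfinitePlace K → ℝ) (hs : ∀ w, s w ≠ 0) :
    ∃ a : K, ∀ w : InfinitePlace K, 0 < s w * (w.embedding a).im := by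
  classical
  set U : Set ((v : InfinitePlace K) → WithAbs v.1) :=
    {y | ∀ w : InfinitePlace K, 0 < s w * (w.embedding (WithAbs.equiv w.1 (y w))).im} with hU
  have hUo : IsOpen U := by
    have : U = ⋂ w : InfinitePlace K,
        {y : (v : InfinitePlace K) → WithAbs v.1 |
          0 < s w * (w.embedding (WithAbs.equiv w.1 (y w))).im} := by
      ext y; simp [hU]
    rw [this]
    refine isOpen_iInter_of_finite fun w => isOpen_lt continuous_const ?_
    exact continuous_const.mul (Complex.continuous_im.comp (continuous_embedding_apply K w))
  have hUne : U.Nonempty := by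
    refine ⟨fun w => (WithAbs.equiv w.1).symm
      (if 0 < s w * (w.embedding a₀).im then a₀ else -a₀), fun w => ?_⟩
    simp only [RingEquiv.apply_symm_apply]
    split_ifs with h
    · exact h
    · rw [map_neg, Complex.neg_im, mul_neg]
      rcases lt_or_gt_of_ne (mul_ne_zero (hs w) (ha₀ w)) with h' | h'
      · linarith
      · exact absurd h' h
  obtain ⟨a, ha⟩ := (denseRange_algebraMap_pi K).exists_mem_open hUo hUne
  refine ⟨a, fun w => ?_⟩
  have := ha w
  simpa [WithAbs.algebraMap_right_apply] using this

end WeakApproximation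

section CMSigns

open NumberField.IsCMField

variable (K : Type*) [Field K] [CharZero K] [IsCMField K] [NumberField K]

/-- In a CM field, an element not fixed by the complex conjugation has non-real image under
EVERY complex embedding. -/
theorem im_embedding_ne_zero_of_complexConj_ne {a : K} (ha : complexConj K a ≠ a)
    (w : InfinitePlace K) : (w.embedding a).im ≠ 0 := by
  intro h
  apply ha
  apply w.embedding.injective
  rw [complexEmbedding_complexConj, Complex.ext_iff]
  simp [h]

/-- **`δ_β` by weak approximation** (ROUTE.md §9.8(f)): for every sign vector `s` on the infinite
places of a CM field `K` there is a purely imaginary `δ ∈ K` (`δ̄ = −δ`, `δ ≠ 0`) whose imaginary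
part under the chosen embedding of each place has the sign of `s w`. -/
theorem exists_complexConj_eq_neg_forall_sign_im (s : InfinitePlace K → ℝ) (hs : ∀ w, s w ≠ 0) :
    ∃ δ : K, δ ≠ 0 ∧ complexConj K δ = -δ ∧
      ∀ w : InfinitePlace K, 0 < s w * (w.embedding δ).im := by
  have hne : ∃ a₀ : K, complexConj K a₀ ≠ a₀ := by
    by_contra hall
    apply complexConj_ne_one K
    ext x
    exact not_not.mp (fun h => hall ⟨x, h⟩)
  obtain ⟨a₀, ha₀⟩ := hne
  obtain ⟨a, ha⟩ := exists_forall_sign_im_embedding K a₀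
    (im_embedding_ne_zero_of_complexConj_ne K ha₀) s hs
  refine ⟨a - complexConj K a, ?_, ?_, fun w => ?_⟩
  · intro h
    rw [sub_eq_zero] at h
    set w₀ : InfinitePlace K := Classical.arbitrary (InfinitePlace K)
    have hw := ha w₀
    have h2 : (w₀.embedding a).im = 0 := by
      have h3 := congrArg (fun x => (w₀.embedding x).im) h
      simp only [complexEmbedding_complexConj, Complex.conj_im] at h3
      linarith
    rw [h2, mul_zero] at hw
    exact lt_irrefl _ hw
  · rw [map_sub, complexConj_apply_apply, neg_sub]
  · have h2 : (w.embedding (a - complexConj K a)).im = 2 * (w.embedding a).im := by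
      rw [map_sub, complexEmbedding_complexConj, Complex.sub_im, Complex.conj_im]; ring
    rw [h2]
    have := ha w
    nlinarith [this]

end CMSigns

end HodgeRepro.T3P1.NormOneHilbert90
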